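import Summits.CriticalPhenomena.PercolationContinuityZ3.Theorems.PercNearOneGluingNoHeavyLowerTailSahiCTCRtThreePeelInduction
import HarnessLib

/-!
# `NoHeavyLowerTail` (crux stmt-CriticalPhenomena-4575), P3 lane: THE EXCHANGE INDUCTION — `R_3 ∈ ℕ[s]` for all pairs of up-sets follows from
# ONE hypothesis-free monotonicity of the coefficients (the EXCHANGE MONOTONICITY (EX)) and two finite bases on ≤ 3 points

Support file (seat `prim-l12-p3`, gen 45; `--supports stmt-CriticalPhenomena-4575`).  Memo
`run/shared/lean/prim/prim-l12/FROM-prim-l12-p3-g45-EXCHANGE-MONOTONICITY.md` §1–§3.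

With `T(n) = coeff_n R_3(𝒳,𝒵)`, gen 45 found the **exchange monotonicity** (census kit j293085, attached to the item: EXHAUSTIVE over all 7581²
ordered pairs of up-sets on 5 points × the profiles (1⁵),(2,1⁴),(2²,1³),(2³,1²) × all ordered pairs of single points = 2.30·10⁹ instances, and 1.26·10⁸
random loop-rich instances on 6–10 points with entries ≤ 3 — 0 failures, in every loop class of `s`, `u` including common loops)
  (EX)  `T(n − e_u + e_s) ≤ T(n)` for any two SINGLE points `s ≠ u` of the profile `n`
("moving the unit of one single point onto another single point does not increase the coefficient"; no loop or adjacency hypothesis).  Since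
`n − e_u + e_s` has two single points fewer, (EX) ALONE drives an induction on the number of single points; the tree supplies the profiles with an entry
`≥ 3` (`coeff_Rt_three_nonneg_of_three_le`), with `≥ 4` doubled points (`coeff_Rt_three_nonneg_of_four_le_card_dbl`) and the drop of a single point at
`3` doubled points (`coeff_Rt_three_drop_of_three_le_card_dbl`), so that only profiles supported on `≤ 3` points remain as bases.
**`coeff_Rt_three_nonneg_of_exchange`** is this induction, with (EX) (restricted to the profiles where it is needed: entries `≤ 2`, `≤ 2` doubled points)
and the two finite bases as inline hypotheses.  It supersedes the four-hypothesis peel induction `coeff_Rt_three_nonneg_of_peels` of gen 44 as the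
lane's reduction of `R_3 ∈ ℕ[s]` (= coefficientwise TP_3).  Nothing is asserted about the crux; (EX) and the bases are NOT proved here.
-/

noncomputable section

open scoped Classical

namespace Summit.CriticalPhenomena.PercolationContinuityZ3.Theorems.SahiCTCForms

open Finset MvPolynomial SahiCTCGenFun

variable {α : Type*} [DecidableEq α] [Fintype α]

omit [Fintype α] in
/-- Moving the unit of the single point `u` onto the single point `s ≠ u` removes both from the single points. [this work] -/
theorem ones_exchange {n : α →₀ ℕ} {s u : α} (hsu : s ≠ u) (hs : n s = 1) (hu : n u = 1) :
    #((n - Finsupp.single u 1 + Finsupp.single s 1).support.filter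
        fun i => (n - Finsupp.single u 1 + Finsupp.single s 1 : α →₀ ℕ) i = 1) + 2 =
      #(n.support.filter fun i => n i = 1) := by
  set m : α →₀ ℕ := n - Finsupp.single u 1 + Finsupp.single s 1 with hm
  have hsub : ({s, u} : Finset α) ⊆ n.support.filter fun i => n i = 1 := by
    intro i hi
    rw [mem_insert, mem_singleton] at hi
    rcases hi with rfl | rfl
    · exact mem_filter.2 ⟨Finsupp.mem_support_iff.2 (by omega), hs⟩
    · exact mem_filter.2 ⟨Finsupp.mem_support_iff.2 (by omega), hu⟩
  have heq : m.support.filter (fun i => m i = 1) = (n.support.filter fun i => n i = 1) \ {s, u} := by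
    ext i
    simp only [hm, mem_filter, Finsupp.mem_support_iff, Finsupp.add_apply, Finsupp.tsub_apply, Finsupp.single_apply, mem_sdiff,
      mem_insert, mem_singleton]
    by_cases his : s = i
    · subst his; simp [hs, hsu, Ne.symm hsu]
    · by_cases hiu : u = i
      · subst hiu; simp [hu, his, Ne.symm hsu]
      · simp only [his, hiu, if_false, tsub_zero, add_zero]
        constructor
        · rintro ⟨h1, h2⟩; exact ⟨⟨h1, h2⟩, fun h => h.elim (fun h => his h.symm) fun h => hiu h.symm⟩
        · rintro ⟨⟨h1, h2⟩, _⟩; exact ⟨h1, h2⟩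
  have hcard2 : #({s, u} : Finset α) = 2 := card_pair hsu
  rw [heq, card_sdiff_of_subset hsub, hcard2]
  have : 2 ≤ #(n.support.filter fun i => n i = 1) := hcard2 ▸ card_le_card hsub
  omega

omit [DecidableEq α] [Fintype α] in
/-- Two distinct single points exist as soon as there are at least two. [this work] -/
theorem exists_two_singles {n : α →₀ ℕ} (h : 2 ≤ #(n.support.filter fun i => n i = 1)) :
    ∃ s u, s ≠ u ∧ n s = 1 ∧ n u = 1 := by
  have h1 : 1 < #(n.support.filter fun i => n i = 1) := by omega
  obtain ⟨s, u, hs, hu, hsu⟩ := one_lt_card_iff.1 h1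
  exact ⟨s, u, hsu, (mem_filter.1 hs).2, (mem_filter.1 hu).2⟩

/-- **THE EXCHANGE INDUCTION.**  If the exchange monotonicity (EX) holds at every profile with entries `≤ 2` and at most two doubled points, and the
two finite bases hold (no single point and `≤ 3` doubled points; exactly one single point and `≤ 2` doubled points — profiles supported on `≤ 3`
points up to the free part), then `R_3(𝒳,𝒵) ∈ ℕ[s]` for every pair of up-sets on `α` (memo g45 §3). [this work] -/
theorem coeff_Rt_three_nonneg_of_exchange
    -- (EX) exchange monotonicity at two single points (memo g45 §1)
    (hEX : ∀ (F G : Finset (Finset α)), IsUpperSet (F : Set (Finset α)) → IsUpperSet (G : Set (Finset α)) →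
      ∀ (n : α →₀ ℕ) (s u : α), s ≠ u → n s = 1 → n u = 1 → (∀ i, n i ≤ 2) → #(dbl n) ≤ 2 →
        (Rt 3 F G).coeff (n - Finsupp.single u 1 + Finsupp.single s 1) ≤ (Rt 3 F G).coeff n)
    -- base 0: entries in {0,2}, at most three doubled points (the 3-point diagonal, memo g44 §1)
    (hB0 : ∀ (F G : Finset (Finset α)), IsUpperSet (F : Set (Finset α)) → IsUpperSet (G : Set (Finset α)) →
      ∀ (n : α →₀ ℕ), (∀ i, n i = 0 ∨ n i = 2) → #(dbl n) ≤ 3 → 0 ≤ (Rt 3 F G).coeff n)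
    -- base 1: exactly one single point, entries ≤ 2, at most two doubled points (≤ 3-point support)
    (hB1 : ∀ (F G : Finset (Finset α)), IsUpperSet (F : Set (Finset α)) → IsUpperSet (G : Set (Finset α)) →
      ∀ (n : α →₀ ℕ), #(n.support.filter fun i => n i = 1) = 1 → (∀ i, n i ≤ 2) → #(dbl n) ≤ 2 → 0 ≤ (Rt 3 F G).coeff n)
    {F G : Finset (Finset α)} (hF : IsUpperSet (F : Set (Finset α))) (hG : IsUpperSet (G : Set (Finset α))) (n : α →₀ ℕ) :
    0 ≤ (Rt 3 F G).coeff n := by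
  -- strong induction on the number of single points, for all pairs of up-sets simultaneously
  suffices key : ∀ k : ℕ, ∀ (F G : Finset (Finset α)), IsUpperSet (F : Set (Finset α)) → IsUpperSet (G : Set (Finset α)) →
      ∀ n : α →₀ ℕ, #(n.support.filter fun i => n i = 1) = k → 0 ≤ (Rt 3 F G).coeff n from key _ F G hF hG n rfl
  intro k
  induction k using Nat.strong_induction_on with
  | _ k ih =>
  intro F G hF hG n hk
  -- an entry ≥ 3: unconditional
  by_cases h3 : ∃ w, 3 ≤ n w
  · obtain ⟨w, hw⟩ := h3; exact coeff_Rt_three_nonneg_of_three_le hF hG hw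
  have h2 : ∀ i, n i ≤ 2 := fun i => by by_contra h; exact h3 ⟨i, by omega⟩
  -- four doubled points: unconditional
  by_cases h4 : 4 ≤ #(dbl n)
  · exact coeff_Rt_three_nonneg_of_four_le_card_dbl hF hG h4
  -- no single point: base 0
  by_cases h0 : #(n.support.filter fun i => n i = 1) = 0
  · exact hB0 F G hF hG n (eq_zero_or_two_of_ones_eq_zero h2 h0) (by omega)
  obtain ⟨s, hs⟩ := exists_single_of_ones_ne_zero h0
  -- three doubled points: drop the single point `s` (tree), one single point fewer
  by_cases hd3 : 3 ≤ #(dbl n)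
  · have hlt : #((n - Finsupp.single s 1).support.filter fun i => (n - Finsupp.single s 1 : α →₀ ℕ) i = 1) < k := by
      rw [← hk, ← ones_tsub_single hs]; omega
    exact (ih _ hlt F G hF hG _ rfl).trans (coeff_Rt_three_drop_of_three_le_card_dbl hF hG hs hd3)
  have hd2 : #(dbl n) ≤ 2 := by omega
  -- exactly one single point: base 1
  by_cases h1 : #(n.support.filter fun i => n i = 1) = 1
  · exact hB1 F G hF hG n h1 h2 hd2
  -- at least two single points: exchange
  obtain ⟨t, u, htu, ht, hu⟩ := exists_two_singles (n := n) (by omega)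
  have hlt : #((n - Finsupp.single u 1 + Finsupp.single t 1).support.filter
      fun i => (n - Finsupp.single u 1 + Finsupp.single t 1 : α →₀ ℕ) i = 1) < k := by
    rw [← hk, ← ones_exchange htu ht hu]; omega
  exact (ih _ hlt F G hF hG _ rfl).trans (hEX F G hF hG n t u htu ht hu h2 hd2)

end Summit.CriticalPhenomena.PercolationContinuityZ3.Theorems.SahiCTCForms
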